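import Summits.CriticalPhenomena.Ising3DConformalLimit.Theorems.PerfectScreeningSubharmonicOffOriginTemperatureDoor
import Summits.CriticalPhenomena.Ising3DConformalLimit.Theorems.PerfectScreeningSubharmonicOffOriginBetheThreshold
import HarnessLib

/-!
# Near shells of `SubharmonicOffOrigin` through the SUBCRITICAL DOOR (crux-strategist r1, typed target)

Crux `stmt-CriticalPhenomena-1341` (`SubharmonicOffOrigin`, route PerfectScreening). Second-opinion
re-framing of the near field (census W2 → W2'): the two near shells `ShellOne` (‖x‖∞ = 1) and
`ShellTwo` (‖x‖∞ = 2) of the prepared shell split follow from the SUBCRITICAL statement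

  `SubcriticalAt x : ∀ β, 1/5 < tanh β → β < β_c(3) → 6·⟨σ₀σ_x⟩⁺_β ≤ Σ_{y∼x} ⟨σ₀σ_y⟩⁺_β`

at the nine site classes of the radius-2 sup-ball, by the landed temperature door
(`TemperatureDoor.laplacian_nonneg_criticalBeta_of_frequently`, ADS15 continuity at `β_c⁻`) and the
landed Bethe-threshold theorem (`Bethe.betheThreshold`: all `x ≠ 0` whenever `tanh β ≤ 1/5`).
Consequences recorded in `STRATEGY-CENSUS-r1.md` §5: the near-shell certificate problem lives on the
t-window `tanh β ∈ (1/5, tanh β_c(3)) = (0.2, 0.2181)` of the UNIQUE-PHASE side only (free = plus state,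
finite-volume two-sided GKS sandwich available), and its typed target needs no numerical value of
`β_c(3)` — `β < β_c` enters only through subcritical structure. (How a certificate would in practice
detect the window's upper end is discussed in the census; this file only types the door.)
Everything here is sorry-free; nothing is asserted about the two-point function itself.
-/

noncomputable section

namespace Summit.CriticalPhenomena.Ising3DConformalLimit.Cruxes.SubharmonicOffOrigin.StrategistR1

open Filter Topology
open Literature.Probability.LatticeModels
open Summit.CriticalPhenomena.Ising3DConformalLimit.Theorems.PerfectScreening

/-- The subcritical lattice-subharmonicity of the plus state at one site `x`, ABOVE the Bethe
threshold and BELOW `β_c(3)` (the open t-window `(1/5, tanh β_c)`). -/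
def SubcriticalAt (x : Site 3) : Prop :=
  ∀ β : ℝ, 1 / 5 < Real.tanh β → β < criticalBeta 3 →
    6 * twoPointPlus 3 β x ≤
      ∑ i : Fin 3, (twoPointPlus 3 β (x + Pi.single i 1) + twoPointPlus 3 β (x - Pi.single i 1))

/-- **Door at one site.** `SubcriticalAt x` (the window above Bethe) together with the landed
Bethe-threshold theorem (the window `tanh β ≤ 1/5`) gives `SubH_β(x)` for every `β ∈ [0, β_c)`, hence
SubH at `β_c` at `x` by the temperature door. [folklore] -/
theorem laplacian_nonneg_of_subcriticalAt (x : Site 3) (hx : x ≠ 0) (h : SubcriticalAt x) :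
    6 * criticalTwoPoint 3 x ≤
      ∑ i : Fin 3, (criticalTwoPoint 3 (x + Pi.single i 1) + criticalTwoPoint 3 (x - Pi.single i 1)) := by
  have h6 : (2 : ℝ) * (3 : ℕ) = 6 := by norm_num
  have key : ∃ᶠ β in 𝓝[<] criticalBeta 3, 6 * twoPointPlus 3 β x ≤
      ∑ i : Fin 3, (twoPointPlus 3 β (x + Pi.single i 1) + twoPointPlus 3 β (x - Pi.single i 1)) := by
    refine Eventually.frequently ?_
    have hβc : 0 < criticalBeta 3 := criticalBeta_pos_holds (d := 3) (by norm_num)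
    have hev : ∀ᶠ β in 𝓝[<] criticalBeta 3, 0 ≤ β ∧ β < criticalBeta 3 := by
      have h1 : ∀ᶠ β in 𝓝[<] criticalBeta 3, β < criticalBeta 3 := self_mem_nhdsWithin
      have h2 : ∀ᶠ β in 𝓝[<] criticalBeta 3, 0 ≤ β :=
        mem_nhdsWithin_of_mem_nhds (eventually_ge_nhds hβc)
      exact h2.and h1
    filter_upwards [hev] with β hβ
    by_cases ht : Real.tanh β ≤ 1 / 5
    · exact Bethe.betheThreshold β hβ.1 ht x hx
    · exact h β (lt_of_not_ge ht) hβ.2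
  have := TemperatureDoor.laplacian_nonneg_criticalBeta_of_frequently (d := 3) le_rfl x
    (by simpa only [h6] using key)
  simpa only [h6] using this

/-- **ShellOne through the subcritical door**: the subcritical statement at the sites of sup-norm 1
gives the child `ShellOne` of the shell split verbatim. [folklore] -/
theorem shellOne_of_subcritical
    (h : ∀ x : Site 3, x ≠ 0 → (∀ j : Fin 3, (x j).natAbs ≤ 1) → SubcriticalAt x) :
    ∀ x : Literature.Probability.LatticeModels.Site 3, x ≠ 0 → (∀ j : Fin 3, (x j).natAbs ≤ 1) → 6 * Literature.Probability.LatticeModels.criticalTwoPoint 3 x ≤ ∑ i : Fin 3, (Literature.Probability.LatticeModels.criticalTwoPoint 3 (x + Pi.single i 1) + Literature.Probability.LatticeModels.criticalTwoPoint 3 (x - Pi.single i 1)) :=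
  fun x hx h1 => laplacian_nonneg_of_subcriticalAt x hx (h x hx h1)

/-- **ShellTwo through the subcritical door**: the subcritical statement at the sites of sup-norm 2
gives the child `ShellTwo` of the shell split verbatim. [folklore] -/
theorem shellTwo_of_subcritical
    (h : ∀ x : Site 3, (∀ j : Fin 3, (x j).natAbs ≤ 2) → (∃ j : Fin 3, (x j).natAbs = 2) → SubcriticalAt x) :
    ∀ x : Literature.Probability.LatticeModels.Site 3, (∀ j : Fin 3, (x j).natAbs ≤ 2) → (∃ j : Fin 3, (x j).natAbs = 2) → 6 * Literature.Probability.LatticeModels.criticalTwoPoint 3 x ≤ ∑ i : Fin 3, (Literature.Probability.LatticeModels.criticalTwoPoint 3 (x + Pi.single i 1) + Literature.Probability.LatticeModels.criticalTwoPoint 3 (x - Pi.single i 1)) := by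
  intro x h2 hx2
  have hx : x ≠ 0 := by
    rintro rfl
    obtain ⟨j, hj⟩ := hx2
    simp at hj
  exact laplacian_nonneg_of_subcriticalAt x hx (h x h2 hx2)

/-- The whole near ball at once: subcriticality above Bethe at every site of the radius-2 sup-ball
gives SubH at `β_c` on that ball (both near children of the split). [folklore] -/
theorem nearBall_of_subcritical
    (h : ∀ x : Site 3, x ≠ 0 → (∀ j : Fin 3, (x j).natAbs ≤ 2) → SubcriticalAt x) :
    ∀ x : Site 3, x ≠ 0 → (∀ j : Fin 3, (x j).natAbs ≤ 2) →
      6 * criticalTwoPoint 3 x ≤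
        ∑ i : Fin 3, (criticalTwoPoint 3 (x + Pi.single i 1) + criticalTwoPoint 3 (x - Pi.single i 1)) :=
  fun x hx h2 => laplacian_nonneg_of_subcriticalAt x hx (h x hx h2)

end Summit.CriticalPhenomena.Ising3DConformalLimit.Cruxes.SubharmonicOffOrigin.StrategistR1
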